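import Summits.Schanuel.Schanuel.Theorems.RootDecomp1KNW96Core16

/-!
# RootDecomp1KNW96Core — lens 6, generation 24, node 3 (g24c) «W78 COR. 3.7 (CIJSOUW'S LOG-α MEASURE) + THE `W78LogMeasure` TWIN, HYPOTHESIS-FREE VIA THE NW96 KERNEL» (RULE G27 (iii); CLAIM L2258, ACK/CHECKLIST G27-α L2260, NODE L2265 / REQUEST L2266; critic VERDICT pending at staging — filed only on GO) — continuation (RootDecomp1KNW96Core17): §W3b `log_approx_cijsouw` + §W4 Cor. 3.7 and the twin, hypothesis-free

(lens-6 g24c HOME kernel K = HOME/decomp-schanuel-lens-6/g24c/NW96W78.lean 0d67db34…, 579 l, imports tree `…RootDecomp1KNW96Core14` + `…RootDecomp1KKummerClosure05` + Literature `…LogAlgebraicTranscendenceMeasure` + `Literature.Uncategorized.W78LogMeasure`; P/C per NODE-g24c.md. Port by census-1 gen 19 as `RootDecomp1KNW96Core16` = §W1 elementary real inequalities (private) + §W2 the degree-monotone approximation function `wphi κ d L = κ·d(log L + d log d)/(1 + log d)` (Cijsouw's shape), `wphi_nonneg/mono`, `kappa_le_mul_wphi` + §W3 `kappaLog`, the pure-real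 lemma `cijsouw_real`; `RootDecomp1KNW96Core17` = §W3 `log_approx_cijsouw (hNW : NesterenkoWaldschmidt1996_thm_1)` (Thm-1 instance θ := λ, α := e^λ, β := ξ, D := [ℚ(e^λ, ξ):ℚ], log A := log M(A_α)+1, log B := h(ξ), E := e·D) + §W4 `waldschmidt1978_cor_3_7_explicit`, `waldschmidt1978_cor_3_7_of_NW1996`, the headlines `waldschmidt1978_cor_3_7_holds : Waldschmidt1978_cor_3_7` (via the tree's `nesterenkoWaldschmidt1996_thm_1_holds`, Core14) and `w78LogMeasure_iff_cor_3_7 := Iff.rfl`, `w78LogMeasure_holds : Literature.Uncategorized.W78LogMeasure` — HYPOTHESIS-FREE.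
PORT EDITS: the file-wide linter option dropped; four generic real/height lemmas private (`mul_one_add_log_le`, `self_le_log_add_mul_log`, `log_absorb`, `length_le_of_height_le`) with per-part private copies; one docstring added (`kappaLog_nonneg`); statements and proofs verbatim. `--supports stmt-Schanuel-33364`; no census credit carried; rung 0 — nothing here proves Schanuel. CONSEQUENCE OF RECORD on GO: the 19 `(hlm : W78LogMeasure)` binders in 9 files (+4 in the Literature file) are dischargeable BY NAME — census relabel ×0.)
-/

namespace Summit.Schanuel.Schanuel.Theorems.RootDecomp1KNW96Core

open Polynomial Complex IntermediateField
open Literature.NumberTheory.Transcendental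
open Summit.Schanuel.Schanuel.Theorems.RootDecomp1KHyper.HyperCell (pair_bounds)

section W78Log

/-- `d ≤ log L + d log d` for an integer `d ≥ 1` and `L ≥ 3` (so `d³ ≤ d² (log L + d log d)`).
[folklore] -/
private theorem self_le_log_add_mul_log {d : ℕ} (hd : 1 ≤ d) {L : ℝ} (hL : 3 ≤ L) :
    (d : ℝ) ≤ Real.log L + d * Real.log d := by
  have hlog3 : 1 < Real.log 3 := by
    rw [Real.lt_log_iff_exp_lt (by norm_num)]
    have := Real.exp_one_lt_d9; norm_num at this ⊢; linarith
  have hlogL : Real.log 3 ≤ Real.log L := Real.log_le_log (by norm_num) hL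
  have hl2 := Real.log_two_gt_d9
  rcases Nat.lt_or_ge d 3 with h | h
  · interval_cases d
    · norm_num; linarith
    · norm_num; linarith
  · have hd3 : (3 : ℝ) ≤ d := by exact_mod_cast h
    have hld : 1 ≤ Real.log d := hlog3.le.trans (Real.log_le_log (by norm_num) hd3)
    nlinarith

/-- The numerical absorptions for `N ≥ 1`, `H ≥ 16`:
`N log 2 + log(N+1) ≤ log H + N log N` and `log 2 + log N + log(N+1) ≤ log H + N log N`. [folklore] -/
private theorem log_absorb {N H : ℕ} (hN : 1 ≤ N) (hH : 16 ≤ H) :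
    (N : ℝ) * Real.log 2 + Real.log ((N : ℝ) + 1) ≤ Real.log H + N * Real.log N ∧
    Real.log 2 + Real.log N + Real.log ((N : ℝ) + 1) ≤ Real.log H + N * Real.log N := by
  have hl2 := Real.log_two_gt_d9
  have hl2' := Real.log_two_lt_d9
  have hH16 : (16 : ℝ) ≤ H := by exact_mod_cast hH
  have hlogH : 4 * Real.log 2 ≤ Real.log H := by
    have : Real.log 16 ≤ Real.log H := Real.log_le_log (by norm_num) hH16
    have h16 : Real.log 16 = 4 * Real.log 2 := by
      rw [show (16 : ℝ) = 2 ^ 4 by norm_num, Real.log_pow]; norm_num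
    linarith
  have hlog3 : Real.log 3 ≤ 4 * Real.log 2 := by
    rw [show 4 * Real.log 2 = Real.log 16 by
      rw [show (16 : ℝ) = 2 ^ 4 by norm_num, Real.log_pow]; norm_num]
    exact Real.log_le_log (by norm_num) (by norm_num)
  have hlog23 : Real.log 2 ≤ Real.log 3 := Real.log_le_log (by norm_num) (by norm_num)
  have hlog30 : 0 ≤ Real.log 3 := Real.log_nonneg (by norm_num)
  have hlog4 : Real.log 4 = 2 * Real.log 2 := by
    rw [show (4 : ℝ) = 2 ^ 2 by norm_num, Real.log_pow]; norm_num
  have hlog1 : Real.log 1 = 0 := Real.log_one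
  rcases Nat.lt_or_ge N 4 with h | h
  · interval_cases N
    · refine ⟨?_, ?_⟩ <;> norm_num <;> linarith
    · refine ⟨?_, ?_⟩ <;> norm_num <;> linarith
    · refine ⟨?_, ?_⟩ <;> norm_num [hlog4] <;> linarith
  · have hN4 : (4 : ℝ) ≤ N := by exact_mod_cast h
    have hN0 : (0 : ℝ) < N := by linarith
    have hlN : 2 * Real.log 2 ≤ Real.log N := hlog4 ▸ Real.log_le_log (by norm_num) hN4
    -- `log (N+1) ≤ N log 2` from `N + 1 ≤ 2^N`, and `log (N+1) ≤ log 2 + log N` from `N + 1 ≤ 2N`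
    have hpow : (N : ℝ) + 1 ≤ 2 ^ N := by exact_mod_cast Nat.lt_two_pow_self
    have hlN1 : Real.log ((N : ℝ) + 1) ≤ N * Real.log 2 := by
      have := Real.log_le_log (by linarith) hpow
      rwa [Real.log_pow] at this
    have hlN1' : Real.log ((N : ℝ) + 1) ≤ Real.log 2 + Real.log N := by
      rw [← Real.log_mul (by norm_num) hN0.ne']
      exact Real.log_le_log (by linarith) (by linarith)
    have hlogH0 : 0 ≤ Real.log H := by linarith
    constructor
    · nlinarith
    · nlinarith

/-- **Approximation measure for `λ`, `e^λ = α ∈ ℚ̄` (Cijsouw's shape, mod NW 1996 Thm 1).**  THE INSTANCE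
of Theorem 1: `θ := λ`, `α := e^λ` (so `|e^θ − α| = 0`), `β := ξ ≠ 0`, `D := [ℚ(e^λ, ξ):ℚ]`,
`A := exp(log M(A_α) + 1)`, `B := exp(h(ξ))` with `h(ξ) = log M(Q_ξ)/deg Q_ξ` EXACTLY (tree
`RoyWaldschmidt1997.MahlerWeil.weilHeight₁_root_eq`), `E := e·D`.  Side conditions: `θ ≠ 0` (h0),
`α ≠ 0` (`exp_ne_zero`), `β ≠ 0` (case split: `ξ = 0` is settled by `|λ| = e^{log|λ|} ≥ e^{−κ} ≥ e^{−dφ}`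
since `κ ≥ |log|λ||` and `dφ ≥ κ`), `α, β` algebraic and `1 ≤ D ≤ deg α · deg ξ` (`pair_bounds`),
`0 < A`, `0 < B`, `e ≤ E` (`D ≥ 1`), `max(h(α), 1/D) ≤ log A` (`h(α) ≤ log M(A_α)`, `1/D ≤ 1`),
`h(β) ≤ log B` (equality).  Conclusion: `|λ − ξ| ≥ exp(−d·φ_κ(d, L))`, `d = deg ξ`, `L(ξ) ≤ L`, `3 ≤ L`,
`κ = kappaLog (deg α) (log M(A_α) + 1) |λ|`; the case `d = 1` is included (`log L ≥ log 3 ≥ 1`).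
[cite: NesterenkoWaldschmidt1996, Theorem 1 and the proof of Theorem 3 (choice `E = eD`)] -/
theorem log_approx_cijsouw (hNW : NesterenkoWaldschmidt1996_thm_1) {lam : ℂ} (h0 : lam ≠ 0)
    {A : ℤ[X]} (hAirr : Irreducible A) (hAdeg : 0 < A.natDegree) (hAα : aeval (cexp lam) A = 0)
    (Q : ℤ[X]) (ξ : ℂ) (L : ℕ) (hQ : Irreducible Q) (hd : 0 < Q.natDegree) (hξ : aeval ξ Q = 0)
    (hlen : (∑ k ∈ Finset.range (Q.natDegree + 1), |Q.coeff k|) ≤ (L : ℤ)) (hL : 3 ≤ L) :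
    Real.exp (-(Q.natDegree * wphi (kappaLog A.natDegree
      (Real.log (A.map (Int.castRingHom ℂ)).mahlerMeasure + 1) ‖lam‖) Q.natDegree L)) ≤ ‖lam - ξ‖ := by
  obtain ⟨a, ha⟩ : ∃ a : ℝ, a = Real.log (A.map (Int.castRingHom ℂ)).mahlerMeasure + 1 := ⟨_, rfl⟩
  rw [← ha]
  have hMA1 : 1 ≤ (A.map (Int.castRingHom ℂ)).mahlerMeasure :=
    Polynomial.one_le_mahlerMeasure_of_ne_zero hAirr.ne_zero
  have hlMA0 : 0 ≤ Real.log (A.map (Int.castRingHom ℂ)).mahlerMeasure := Real.log_nonneg hMA1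
  have ha1 : 1 ≤ a := by rw [ha]; linarith
  have ha0 : 0 < a := by linarith
  have hT0 : 0 ≤ ‖lam‖ := norm_nonneg _
  have hTpos : 0 < ‖lam‖ := norm_pos_iff.mpr h0
  have hd1 : (1 : ℝ) ≤ Q.natDegree := by exact_mod_cast hd
  have hd0 : (0 : ℝ) < Q.natDegree := by linarith
  have hn1 : (1 : ℝ) ≤ A.natDegree := by exact_mod_cast hAdeg
  have hL3 : (3 : ℝ) ≤ L := by exact_mod_cast hL
  have hL0 : (0 : ℝ) < L := by linarith
  have hlogL1 : 1 ≤ Real.log (L : ℝ) := by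
    have h3 : 1 < Real.log 3 := by
      rw [Real.lt_log_iff_exp_lt (by norm_num)]
      have := Real.exp_one_lt_d9; norm_num at this ⊢; linarith
    exact h3.le.trans (Real.log_le_log (by norm_num) hL3)
  have hκ0 : 0 ≤ kappaLog A.natDegree a ‖lam‖ := kappaLog_nonneg hAdeg ha1 hT0
  have hK₀ : 0 ≤ 1055 * (a + 6 * ‖lam‖ + 6) * (A.natDegree : ℝ) ^ 3 *
      (19 + 6 * Real.log (A.natDegree : ℝ) + Real.log a + 2 * Real.log (max 1 ‖lam‖)) := by
    have h1 : 0 ≤ Real.log (A.natDegree : ℝ) := Real.log_nonneg hn1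
    have h2 : 0 ≤ Real.log a := Real.log_nonneg ha1
    have h3 : 0 ≤ Real.log (max 1 ‖lam‖) := Real.log_nonneg (le_max_left _ _)
    positivity
  have hκT : |Real.log ‖lam‖| ≤ kappaLog A.natDegree a ‖lam‖ := by unfold kappaLog; linarith
  have hκK : 1055 * (a + 6 * ‖lam‖ + 6) * (A.natDegree : ℝ) ^ 3 *
      (19 + 6 * Real.log (A.natDegree : ℝ) + Real.log a + 2 * Real.log (max 1 ‖lam‖)) ≤
      kappaLog A.natDegree a ‖lam‖ := by unfold kappaLog; linarith [abs_nonneg (Real.log ‖lam‖)]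
  -- `d φ ≥ κ ≥ |log |λ||`
  have hbig : |Real.log ‖lam‖| ≤ (Q.natDegree : ℝ) * wphi (kappaLog A.natDegree a ‖lam‖) Q.natDegree L :=
    hκT.trans (kappa_le_mul_wphi hκ0 hd hL)
  by_cases hξ0 : ξ = 0
  · rw [hξ0, sub_zero]
    have h1 : Real.exp (-((Q.natDegree : ℝ) * wphi (kappaLog A.natDegree a ‖lam‖) Q.natDegree L)) ≤
        Real.exp (Real.log ‖lam‖) :=
      Real.exp_le_exp.mpr (by linarith [neg_abs_le (Real.log ‖lam‖)])
    rwa [Real.exp_log hTpos] at h1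
  -- Theorem 1 at `θ = λ`, `α = e^λ`, `β = ξ`, `A = e^a`, `B = e^b`, `E = e·D`
  obtain ⟨hαalg, hξalg, hD1, hDle, hhα, -⟩ := pair_bounds Q hQ hd hξ A hAirr.ne_zero hAα
  set D : ℕ := Module.finrank ℚ (IntermediateField.adjoin ℚ ({cexp lam, ξ} : Set ℂ)) with hDdef
  haveI : FiniteDimensional ℚ (IntermediateField.adjoin ℚ ({cexp lam, ξ} : Set ℂ)) := by
    refine IntermediateField.finiteDimensional_adjoin fun x hx => ?_
    simp only [Set.mem_insert_iff, Set.mem_singleton_iff] at hx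
    rcases hx with rfl | rfl
    · exact isAlgebraic_iff_isIntegral.mp hαalg
    · exact isAlgebraic_iff_isIntegral.mp hξalg
  have hξK : ξ ∈ IntermediateField.adjoin ℚ ({cexp lam, ξ} : Set ℂ) :=
    IntermediateField.subset_adjoin ℚ _ (by simp)
  -- the exact height of `ξ`, and `d ≤ D ≤ nα d`
  have hMQ1 : 1 ≤ (Q.map (Int.castRingHom ℂ)).mahlerMeasure :=
    Polynomial.one_le_mahlerMeasure_of_ne_zero hQ.ne_zero
  have hMQL : (Q.map (Int.castRingHom ℂ)).mahlerMeasure ≤ L := by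
    refine (NesterenkoWaldschmidt1996.mahlerMeasure_le_length Q).trans ?_
    exact_mod_cast hlen
  obtain ⟨b, hb⟩ : ∃ b : ℝ, b = Real.log (Q.map (Int.castRingHom ℂ)).mahlerMeasure / Q.natDegree :=
    ⟨_, rfl⟩
  have hb0 : 0 ≤ b := by rw [hb]; exact div_nonneg (Real.log_nonneg hMQ1) hd0.le
  have hbL : b ≤ Real.log L / Q.natDegree := by
    rw [hb]; exact div_le_div_of_nonneg_right (Real.log_le_log (by linarith) hMQL) hd0.le
  have hhξ : weilHeight₁ (IntermediateField.adjoin ℚ ({cexp lam, ξ} : Set ℂ)) (fun _ : Unit => ξ) = b := by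
    rw [hb]
    exact RoyWaldschmidt1997.MahlerWeil.weilHeight₁_root_eq Q hQ hd hξ _ hξK
  have hDr1 : (1 : ℝ) ≤ D := by exact_mod_cast hD1
  have hDr0 : (0 : ℝ) < D := by linarith
  have hDle' : (D : ℝ) ≤ (A.natDegree : ℝ) * Q.natDegree := by
    have : (D : ℝ) ≤ ((A.natDegree * Q.natDegree : ℕ) : ℝ) := by exact_mod_cast hDle
    push_cast at this
    exact this
  have hdD : (Q.natDegree : ℝ) ≤ D := by
    have h1 : Module.finrank ℚ (IntermediateField.adjoin ℚ ({ξ} : Set ℂ)) = Q.natDegree :=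
      NesterenkoWaldschmidt1996.finrank_adjoin_eq_natDegree hQ hd hξ
    have h2 : IntermediateField.adjoin ℚ ({ξ} : Set ℂ) ≤ IntermediateField.adjoin ℚ ({cexp lam, ξ} : Set ℂ) :=
      IntermediateField.adjoin.mono ℚ _ _ (by simp)
    have h3 := IntermediateField.finrank_le_of_le_right h2
    rw [h1] at h3
    exact_mod_cast h3
  -- the side conditions of Theorem 1
  have hAcond : max (weilHeight₁ (IntermediateField.adjoin ℚ ({cexp lam, ξ} : Set ℂ))
      (fun _ : Unit => cexp lam)) (1 / (D : ℝ)) ≤ Real.log (Real.exp a) := by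
    rw [Real.log_exp]
    refine max_le (hhα.trans (by rw [ha]; linarith)) ?_
    rw [div_le_iff₀ hDr0]; nlinarith
  have hBcond : weilHeight₁ (IntermediateField.adjoin ℚ ({cexp lam, ξ} : Set ℂ)) (fun _ : Unit => ξ) ≤
      Real.log (Real.exp b) := by
    rw [Real.log_exp, hhξ]
  have hE : Real.exp 1 ≤ Real.exp 1 * D := le_mul_of_one_le_right (Real.exp_pos 1).le hDr1
  have hmain := hNW lam (cexp lam) ξ (Real.exp a) (Real.exp b) (Real.exp 1 * D) h0 (Complex.exp_ne_zero _)
    hξ0 hαalg hξalg (Real.exp_pos a) (Real.exp_pos b) hE hAcond hBcond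
  rw [← hDdef] at hmain
  have he0 : (0 : ℝ) < Real.exp 1 := Real.exp_pos 1
  have hlogE : Real.log (Real.exp 1 * (D : ℝ)) = 1 + Real.log D := by
    rw [Real.log_mul he0.ne' hDr0.ne', Real.log_exp]
  have hlogEm : Real.log (Real.exp 1 * (D : ℝ) * max 1 ‖lam‖) = 1 + Real.log D + Real.log (max 1 ‖lam‖) := by
    rw [Real.log_mul (by positivity) (by positivity), hlogE]
  simp only [Real.log_exp, sub_self, norm_zero, zero_add] at hmain
  rw [hlogEm, hlogE] at hmain
  refine le_trans (Real.exp_le_exp.mpr ?_) hmain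
  rw [neg_le_neg_iff]
  -- the real-variable analysis
  have hreal := cijsouw_real ha1 hT0 hd1 hdD hDle' hn1 hb0 hbL hlogL1
    (self_le_log_add_mul_log hd hL3) hκK
  have hw : (Q.natDegree : ℝ) * wphi (kappaLog A.natDegree a ‖lam‖) Q.natDegree L =
      kappaLog A.natDegree a ‖lam‖ * ((Q.natDegree : ℝ) ^ 2 *
        (Real.log L + Q.natDegree * Real.log Q.natDegree) / (1 + Real.log Q.natDegree)) := by
    unfold wphi; ring
  rw [hw]
  exact le_trans (le_of_eq (by ring)) hreal

/-! ### §W4. Waldschmidt 1978 Cor. 3.7 from NW96 Theorem 1, and hypothesis-free -/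

/-- length `Σ_{k ≤ deg P} |a_k| ≤ (N+1)·H` from `deg P ≤ N` and the usual height `≤ H`. [folklore] -/
private theorem length_le_of_height_le {P : ℤ[X]} {N H : ℕ} (hdeg : P.natDegree ≤ N)
    (hcoef : ∀ k, |P.coeff k| ≤ (H : ℤ)) :
    (∑ k ∈ Finset.range (P.natDegree + 1), |P.coeff k|) ≤ (((N + 1) * H : ℕ) : ℤ) := by
  calc (∑ k ∈ Finset.range (P.natDegree + 1), |P.coeff k|)
      ≤ ∑ _k ∈ Finset.range (P.natDegree + 1), (H : ℤ) := Finset.sum_le_sum fun k _ => hcoef k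
    _ = (P.natDegree + 1 : ℕ) * (H : ℤ) := by simp [Finset.sum_const, Finset.card_range]
    _ ≤ (((N + 1) * H : ℕ) : ℤ) := by
        push_cast
        have hH : (0 : ℤ) ≤ H := by positivity
        have : ((P.natDegree : ℤ) + 1) ≤ (N : ℤ) + 1 := by exact_mod_cast Nat.succ_le_succ hdeg
        nlinarith

/-- **Waldschmidt 1978, Cor. 3.7 with the constant DISPLAYED (mod NW96 Theorem 1).**  For `λ ≠ 0` and
`A_α ∈ ℤ[X]` irreducible of positive degree with `A_α(e^λ) = 0`:
`C(λ) := 2·kappaLog (deg A_α) (log M(A_α) + 1) |λ| + 2` serves in Cor. 3.7, i.e.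
`|P(λ)| ≥ exp(−C(λ) N²(log H + N log N)/(1 + log N))` for `P ≠ 0`, `deg P ≤ N`, `1 ≤ N`, height `≤ H`,
`16 ≤ H`.  Assembly: `L := (N+1)·H ≥ L(P)` (`length_le_of_height_le`), `3 ≤ L`; Fel'dman's transference
(tree `NesterenkoWaldschmidt1996.transcendenceMeasure_of_approximationMeasure`, [NW96, Lemma 1] =
[Fel'dman 1982, Lemma 3.7]) with `φ = wphi κ` (`wphi_nonneg`, `wphi_mono`) fed by `log_approx_cijsouw`;
then the `2^N`-loss and the length are absorbed by `log_absorb`: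
`N·φ(N, 2^N L) ≤ 2κ N²(log H + N log N)/(1 + log N)` and `N log(2NL) ≤ 2N(log H + N log N)
≤ 2N²(log H + N log N)/(1 + log N)` (`1 + log N ≤ N`).
[cite: Waldschmidt1978, Cor. 3.7; NesterenkoWaldschmidt1996, Theorem 1, Lemma 1, Theorem 6 (1)] -/
theorem waldschmidt1978_cor_3_7_explicit (hNW : NesterenkoWaldschmidt1996_thm_1) {lam : ℂ} (h0 : lam ≠ 0)
    {A : ℤ[X]} (hAirr : Irreducible A) (hAdeg : 0 < A.natDegree) (hAα : aeval (cexp lam) A = 0)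
    (P : ℤ[X]) (N H : ℕ) (hP : P ≠ 0) (hN : 1 ≤ N) (hdeg : P.natDegree ≤ N) (hH : 16 ≤ H)
    (hcoef : ∀ k, |P.coeff k| ≤ (H : ℤ)) :
    Real.exp (-((2 * kappaLog A.natDegree (Real.log (A.map (Int.castRingHom ℂ)).mahlerMeasure + 1) ‖lam‖
      + 2) * (N : ℝ) ^ 2 * (Real.log H + N * Real.log N) / (1 + Real.log N))) ≤ ‖aeval lam P‖ := by
  set κ : ℝ := kappaLog A.natDegree (Real.log (A.map (Int.castRingHom ℂ)).mahlerMeasure + 1) ‖lam‖ with hκ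
  have hMA1 : 1 ≤ (A.map (Int.castRingHom ℂ)).mahlerMeasure :=
    Polynomial.one_le_mahlerMeasure_of_ne_zero hAirr.ne_zero
  have hκ0 : 0 ≤ κ := kappaLog_nonneg hAdeg (by linarith [Real.log_nonneg hMA1]) (norm_nonneg _)
  -- length and the transference
  set L : ℕ := (N + 1) * H with hLdef
  have hL3 : 3 ≤ L := by
    rw [hLdef]; calc 3 ≤ 2 * 16 := by norm_num
      _ ≤ (N + 1) * H := Nat.mul_le_mul (by omega) hH
  have hlen : (∑ k ∈ Finset.range (P.natDegree + 1), |P.coeff k|) ≤ (L : ℤ) :=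
    length_le_of_height_le hdeg hcoef
  have key := NesterenkoWaldschmidt1996.transcendenceMeasure_of_approximationMeasure lam (wphi κ)
    (fun n L' => wphi_nonneg hκ0 n L') (fun n m L' h => wphi_mono hκ0 n m L' h)
    (fun Q ξ L' hQ hn hξ hlen' hL' => log_approx_cijsouw hNW h0 hAirr hAdeg hAα Q ξ L' hQ hn hξ hlen' hL')
    P hP N L hN hdeg hlen hL3
  refine le_trans (Real.exp_le_exp.mpr ?_) key
  rw [neg_le_neg_iff]
  -- numerics
  have hN1 : (1 : ℝ) ≤ N := by exact_mod_cast hN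
  have hN0 : (0 : ℝ) < N := by linarith
  have hH16 : (16 : ℝ) ≤ H := by exact_mod_cast hH
  have hH0 : (0 : ℝ) < H := by linarith
  obtain ⟨hab1, hab2⟩ := log_absorb hN hH
  set lN : ℝ := Real.log N with hlN
  have hlN0 : 0 ≤ lN := Real.log_nonneg hN1
  have hlNN : 1 + lN ≤ N := by
    have := Real.log_le_sub_one_of_pos hN0; rw [← hlN] at this; linarith
  have hP1 : 0 < 1 + lN := by linarith
  have hl2 : 0 < Real.log 2 := Real.log_pos (by norm_num)
  have hlogH : 0 ≤ Real.log (H : ℝ) := Real.log_nonneg (by linarith)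
  set GH : ℝ := Real.log H + N * lN with hGH
  have hGH0 : 0 ≤ GH := by positivity
  have hLR : ((2 ^ N * L : ℕ) : ℝ) = 2 ^ N * (((N : ℝ) + 1) * H) := by rw [hLdef]; push_cast; ring
  have hlog2L : Real.log ((2 ^ N * L : ℕ) : ℝ) = N * Real.log 2 + Real.log ((N : ℝ) + 1) + Real.log H := by
    rw [hLR, Real.log_mul (by positivity) (by positivity), Real.log_mul (by positivity) hH0.ne',
      Real.log_pow]
    ring
  have hlog2NL : Real.log (2 * (N : ℝ) * (L : ℝ)) = Real.log 2 + lN + Real.log ((N : ℝ) + 1) + Real.log H := by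
    have : (L : ℝ) = ((N : ℝ) + 1) * H := by rw [hLdef]; push_cast; ring
    rw [this, show 2 * (N : ℝ) * (((N : ℝ) + 1) * H) = (2 * N) * ((N + 1) * H) by ring,
      Real.log_mul (by positivity) (by positivity), Real.log_mul (by norm_num) hN0.ne',
      Real.log_mul (by positivity) hH0.ne']
    ring
  have hNlN : 0 ≤ (N : ℝ) * lN := by positivity
  have hGHH : Real.log (H : ℝ) ≤ GH := by rw [hGH]; linarith
  have hS1 : Real.log ((2 ^ N * L : ℕ) : ℝ) + N * lN ≤ 2 * GH := by rw [hlog2L]; linarith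
  have hS2 : Real.log (2 * (N : ℝ) * (L : ℝ)) ≤ 2 * GH := by rw [hlog2NL]; linarith
  have hS20 : 0 ≤ Real.log (2 * (N : ℝ) * (L : ℝ)) := by
    have hL3r : (3 : ℝ) ≤ L := by exact_mod_cast hL3
    exact Real.log_nonneg (by nlinarith)
  -- `N φ(N, 2^N L) = κ N² (log(2^N L) + N log N)/(1 + log N)`
  have hterm1 : (N : ℝ) * wphi κ N (2 ^ N * L) ≤ 2 * κ * (N : ℝ) ^ 2 * GH / (1 + lN) := by
    have e1 : (N : ℝ) * wphi κ N (2 ^ N * L) =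
        κ * (N : ℝ) ^ 2 * (Real.log ((2 ^ N * L : ℕ) : ℝ) + N * lN) / (1 + lN) := by
      rw [wphi, ← hlN]; ring
    rw [e1]
    refine div_le_div_of_nonneg_right ?_ hP1.le
    have := mul_le_mul_of_nonneg_left hS1 (by positivity : (0 : ℝ) ≤ κ * (N : ℝ) ^ 2)
    linarith
  have hterm2 : (N : ℝ) * Real.log (2 * (N : ℝ) * (L : ℝ)) ≤ 2 * (N : ℝ) ^ 2 * GH / (1 + lN) := by
    rw [le_div_iff₀ hP1]
    have h1 : (N : ℝ) * Real.log (2 * (N : ℝ) * (L : ℝ)) * (1 + lN) ≤ (N : ℝ) * (2 * GH) * N := by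
      gcongr
    nlinarith [h1]
  have hsum : (N : ℝ) * (wphi κ N (2 ^ N * L) + Real.log (2 * (N : ℝ) * (L : ℝ))) ≤
      (2 * κ + 2) * (N : ℝ) ^ 2 * GH / (1 + lN) := by
    rw [mul_add, show (2 * κ + 2) * (N : ℝ) ^ 2 * GH / (1 + lN) =
      2 * κ * (N : ℝ) ^ 2 * GH / (1 + lN) + 2 * (N : ℝ) ^ 2 * GH / (1 + lN) by ring]
    exact add_le_add hterm1 hterm2
  simpa [hGH, hlN] using hsum

/-- **Waldschmidt 1978, Corollary 3.7 (Cijsouw's transcendence measure for `log α`) mod NW96 Theorem 1**: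
the registered statement, with `C := C(λ)` of `waldschmidt1978_cor_3_7_explicit` at an irreducible integer
polynomial of `e^λ` (`NesterenkoWaldschmidt1996.exists_irreducible_int_aeval_eq_zero`).
[cite: Waldschmidt1978, Cor. 3.7; NesterenkoWaldschmidt1996, Theorem 6 (1)] -/
theorem waldschmidt1978_cor_3_7_of_NW1996 (hNW : NesterenkoWaldschmidt1996_thm_1) :
    Waldschmidt1978_cor_3_7 := by
  intro lam h0 halg
  obtain ⟨A, hAirr, hAdeg, hAα⟩ := NesterenkoWaldschmidt1996.exists_irreducible_int_aeval_eq_zero halg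
  have hMA1 : 1 ≤ (A.map (Int.castRingHom ℂ)).mahlerMeasure :=
    Polynomial.one_le_mahlerMeasure_of_ne_zero hAirr.ne_zero
  have hκ0 : 0 ≤ kappaLog A.natDegree (Real.log (A.map (Int.castRingHom ℂ)).mahlerMeasure + 1) ‖lam‖ :=
    kappaLog_nonneg hAdeg (by linarith [Real.log_nonneg hMA1]) (norm_nonneg _)
  exact ⟨_, by positivity, fun P N H hP hN hdeg hH hcoef =>
    waldschmidt1978_cor_3_7_explicit hNW h0 hAirr hAdeg hAα P N H hP hN hdeg hH hcoef⟩

/-- **Waldschmidt 1978, Corollary 3.7 — HYPOTHESIS-FREE** (the registered Literature fact BY NAME), by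
`waldschmidt1978_cor_3_7_of_NW1996` and the tree's `nesterenkoWaldschmidt1996_thm_1_holds`.
[cite: Waldschmidt1978, Cor. 3.7] -/
theorem waldschmidt1978_cor_3_7_holds : Waldschmidt1978_cor_3_7 :=
  waldschmidt1978_cor_3_7_of_NW1996 nesterenkoWaldschmidt1996_thm_1_holds

/-- The vendored twin `Literature.Uncategorized.W78LogMeasure` has the byte-identical body. -/
theorem w78LogMeasure_iff_cor_3_7 : Literature.Uncategorized.W78LogMeasure ↔ Waldschmidt1978_cor_3_7 :=
  Iff.rfl

/-- **`W78LogMeasure` — HYPOTHESIS-FREE**: the `hlm` binder of `RootDecomp1KHyper02/05/17/19` and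
`RootDecomp1KKummerClosure02–05/Cells` is a theorem. [cite: Waldschmidt1978, Cor. 3.7] -/
theorem w78LogMeasure_holds : Literature.Uncategorized.W78LogMeasure :=
  waldschmidt1978_cor_3_7_holds

end W78Log

end Summit.Schanuel.Schanuel.Theorems.RootDecomp1KNW96Core
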